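import Summits.BirchSwinnertonDyer.BirchSwinnertonDyer.Theorems.ByReductionTypeAtTwoAdditivePotMultConjATwoNarrowTwo15820TotPos
import Summits.BirchSwinnertonDyer.BirchSwinnertonDyer.Theorems.ByReductionTypeAtTwoAdditivePotMultConjATwoNarrowRoadKitLayerTwo
import Summits.BirchSwinnertonDyer.BirchSwinnertonDyer.Theorems.ByReductionTypeAtTwoFineSelmerConjAAtTwoAdditivePotGoodNarrowRankCertificate316LayerTwo
import HarnessLib

/-!
# C4″ `AdditivePotMultOverKAtTwo` (item stmt-BirchSwinnertonDyer-22618), the (I1M′) input of the upper half on the `0 < Δ` rows: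
# LAYER-TWO NARROW CERTIFICATE `d = 15820`, part INTEGERS — the integers `θ, ω, p = e/η` of `A₂ = ℚ(θ) ⊔ ℚ_2 = ℚ(θ, √(2+√2))`
# (`𝓞 A₂ = ℤ[θ,ω] ⊕ ℤ[θ,ω]·p`) with their values and relations (KERNEL; rows 316400cm1)

Cell `bsd-2adic`, rung K4, seat `bsd-2adic-k4-w3` GEN 14 (explicit unit of director-bsd g16 (309)(7); `--supports stmt-BirchSwinnertonDyer-22618`).
HONEST FRAMING (D-0036/D-0054/D-0152): THEOREMS ONLY (no definition, no named fact, no `sorry`, no instance). The series `…NarrowTwo15820{Class, Field,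
Dyadic, Residues, TotPos, Integers, Parity, SignsA/B/C, Units, Rows}` carries k4-w1 GEN 11's zero-hypothesis LAYER-TWO narrow certificate (row `261648q1`,
`…NarrowRankCertificate316*`: `h(A₁)`, `h(A₂)` odd by genus theory with one dyadic non-norm unit, ONE totally positive non-square unit of `A₁ = ℚ(θ,√2)`,
ELEVEN sign-independent units of `A₂ = ℚ(θ,√(2+√2))`, k4-w2's Edgar–Mollin–Peterson door `a = 1, b = 11`, cruxlead-19573-w2's rung `m = 1`) to the
totally real cubic `2`-torsion field of discriminant `15820` (`X³ + (-49)X² + (-20)X + (-2)`) of the C4″ census rows 316400cm1 (eng-2 CERT-ADD-POTMULT-POS81-AB-E2: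
`n₀ = 0`, `rank₂ Cl⁺ = [0,1,1]`, unit signature ranks `[3,5,11]`, `h = 1` at layers `0,1,2` — letter NARROW-EQUAL12, instrument grade `grh`; here KERNEL).
All certificates were found by the seat's exact-arithmetic tools (`k4w3/gen13/tools` run by GEN 14: GEN 12 `narrowcert/unitlib` + layer-two arithmetic `nf12/cert3`, multiplicative LLL unit reduction) and are CHECKED
HERE by the kernel. Statement (A) is NOT BSD: BSD₂ for these curves is not proved; C4″ / (I1M′) stay research-open; nothing booked; no row of 22618 changes tier
(pen RC-490 (4)); BSD is not proved by any of this.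

References: [CoatesSujatha2005] Conj. A, Thm. 3.4; [Fukuda1994] Thm. 1 (2); [EdgarMollinPeterson1986] Thm. 2.1; [FrohlichTaylor1990] Ch. V §1 (1.8)–(1.13);
[Lang1990] Ch. 13 §4 Lemma 4.1; [Washington1997] §13.1, Prop. 13.2; [Cohen1993] §4.1.3, §6.3; [Marcus1977] Ch. 5 Thm. 22, 35–37; [Omeara1963] §63.
-/

set_option autoImplicit false
-- sibling precedent: the directory name repeats the summit name
set_option linter.dupNamespace false

noncomputable section

open scoped Classical IntermediateField NumberField nonZeroDivisors Polynomial

namespace Summit.BirchSwinnertonDyer.BirchSwinnertonDyer.Theorems.AddKatoTwo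

open Polynomial IsDedekindDomain NumberField Field IntermediateField
  Literature.NumberTheory.EllipticCurves Literature.NumberTheory.EllipticCurves.ZpExtension
  Literature.NumberTheory.IwasawaTheory Literature.NumberTheory.NumberFields
  Literature.NumberTheory.GaloisRepresentations Literature.Geometry.Kaehler.ComplexTorus

variable {θ : AlgebraicClosure ℚ}

set_option linter.unusedSimpArgs false in
set_option maxHeartbeats 1600000 in
/-- **The integers `b = θ`, `ω` (generator of `𝓞 A₁` over `ℤ[θ]`), `p = e/η` of `A₂ = ℚ(θ) ⊔ ℚ_2`** (`θ³ + (-49)θ² + (-20)θ + (-2) = 0`, `d = 15820`; `e ∈ ℚ_2` a root of `Ψ₂`, `t = e² − 2 = √2`,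
`η = 1 + ω + 5 * θ * ω` the second dyadic prime of `A₁`): values `ω = ((0) + t * (-20 - 49 * θ + θ ^ 2)) / 2`, `p = e·((20 + 49 * θ - θ ^ 2) + t·(51 + 246 * θ - 5 * θ ^ 2))/2`, and relations
`-2 - 20 * θ - 49 * θ ^ 2 + θ ^ 3 = 0`, `ω² = (0) * ω + (151 + 491 * θ - 10 * θ ^ 2)`, `p² = 810 - 121 * ω + 3442 * θ - 541 * θ * ω - 70 * θ ^ 2 + 11 * θ ^ 2 * ω` (`𝓞 A₂ = ℤ[θ, ω] ⊕ ℤ[θ, ω]·p`, found by the seat's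
`2`-maximal-order computation — not needed); `ω` is integral by its monic sextic, `p` as a square root of an integer. KERNEL. [cite: Cohen1993, §4.8.2 and §6.3] [cite: Washington1997, §13.1] -/
theorem layer_two_integers_d15820 (hθ : aeval θ (Cubic.toPoly ⟨1, ((-49 : ℤ) : ℚ), ((-20 : ℤ) : ℚ), ((-2 : ℤ) : ℚ)⟩) = 0)
    {e : AlgebraicClosure ℚ} (he : e ∈ (CyclotomicZp.zpExtension 2).layer 2) (he0 : (fun x : AlgebraicClosure ℚ => x ^ 2 - 2)^[2] e = 0) :
    haveI : FiniteDimensional ℚ ↥ℚ⟮θ⟯ :=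
      IntermediateField.adjoin.finiteDimensional ⟨_, Cubic.monic_of_a_eq_one', by rwa [← aeval_def]⟩
    haveI : FiniteDimensional ℚ ↥((CyclotomicZp.zpExtension 2).layer 2) := (CyclotomicZp.zpExtension 2).finiteDimensional_layer_holds 2
    ∃ bB xB pB : 𝓞 ↥(ℚ⟮θ⟯ ⊔ (CyclotomicZp.zpExtension 2).layer 2),
      (bB : ↥(ℚ⟮θ⟯ ⊔ (CyclotomicZp.zpExtension 2).layer 2)) = inclusion (le_sup_left : ℚ⟮θ⟯ ≤ ℚ⟮θ⟯ ⊔ (CyclotomicZp.zpExtension 2).layer 2) (AdjoinSimple.gen ℚ θ) ∧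
      (xB : ↥(ℚ⟮θ⟯ ⊔ (CyclotomicZp.zpExtension 2).layer 2)) = (((0) + ((⟨e, (le_sup_right : (CyclotomicZp.zpExtension 2).layer 2 ≤ _) he⟩ : ↥(ℚ⟮θ⟯ ⊔ (CyclotomicZp.zpExtension 2).layer 2)) ^ 2 - 2) * (-20 - 49 * inclusion (le_sup_left : ℚ⟮θ⟯ ≤ ℚ⟮θ⟯ ⊔ (CyclotomicZp.zpExtension 2).layer 2) (AdjoinSimple.gen ℚ θ) + inclusion (le_sup_left : ℚ⟮θ⟯ ≤ ℚ⟮θ⟯ ⊔ (CyclotomicZp.zpExtension 2).layer 2) (AdjoinSimple.gen ℚ θ) ^ 2)) / 2) ∧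
      (pB : ↥(ℚ⟮θ⟯ ⊔ (CyclotomicZp.zpExtension 2).layer 2)) = ((⟨e, (le_sup_right : (CyclotomicZp.zpExtension 2).layer 2 ≤ _) he⟩ : ↥(ℚ⟮θ⟯ ⊔ (CyclotomicZp.zpExtension 2).layer 2)) * ((20 + 49 * inclusion (le_sup_left : ℚ⟮θ⟯ ≤ ℚ⟮θ⟯ ⊔ (CyclotomicZp.zpExtension 2).layer 2) (AdjoinSimple.gen ℚ θ) - inclusion (le_sup_left : ℚ⟮θ⟯ ≤ ℚ⟮θ⟯ ⊔ (CyclotomicZp.zpExtension 2).layer 2) (AdjoinSimple.gen ℚ θ) ^ 2) + ((⟨e, (le_sup_right : (CyclotomicZp.zpExtension 2).layer 2 ≤ _) he⟩ : ↥(ℚ⟮θ⟯ ⊔ (CyclotomicZp.zpExtension 2).layer 2)) ^ 2 - 2) * (51 + 246 * inclusion (le_sup_left : ℚ⟮θ⟯ ≤ ℚ⟮θ⟯ ⊔ (CyclotomicZp.zpExtension 2).layer 2) (AdjoinSimple.gen ℚ θ) - 5 * inclusion (le_sup_left : ℚ⟮θ⟯ ≤ ℚ⟮θ⟯ ⊔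 (CyclotomicZp.zpExtension 2).layer 2) (AdjoinSimple.gen ℚ θ) ^ 2)) / 2) ∧
      -2 - 20 * bB - 49 * bB ^ 2 + bB ^ 3 = 0 ∧ xB ^ 2 = (0) * xB + (151 + 491 * bB - 10 * bB ^ 2) ∧
      pB ^ 2 = 810 - 121 * xB + 3442 * bB - 541 * bB * xB - 70 * bB ^ 2 + 11 * bB ^ 2 * xB := by
  haveI : FiniteDimensional ℚ ↥ℚ⟮θ⟯ :=
    IntermediateField.adjoin.finiteDimensional ⟨_, Cubic.monic_of_a_eq_one', by rwa [← aeval_def]⟩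
  haveI : FiniteDimensional ℚ ↥((CyclotomicZp.zpExtension 2).layer 2) := (CyclotomicZp.zpExtension 2).finiteDimensional_layer_holds 2
  haveI : NumberField ↥ℚ⟮θ⟯ := NumberField.mk
  haveI : NumberField ↥(ℚ⟮θ⟯ ⊔ (CyclotomicZp.zpExtension 2).layer 2) := NumberField.mk
  have hKA : ℚ⟮θ⟯ ≤ ℚ⟮θ⟯ ⊔ (CyclotomicZp.zpExtension 2).layer 2 := le_sup_left
  have heA : e ∈ ℚ⟮θ⟯ ⊔ (CyclotomicZp.zpExtension 2).layer 2 := (le_sup_right : (CyclotomicZp.zpExtension 2).layer 2 ≤ _) he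
  set e'' : ↥(ℚ⟮θ⟯ ⊔ (CyclotomicZp.zpExtension 2).layer 2) := ⟨e, heA⟩ with he''def
  obtain ⟨-, ht2⟩ := sq_sub_two_mem_layer_one_d316 he0
  set t'' : ↥(ℚ⟮θ⟯ ⊔ (CyclotomicZp.zpExtension 2).layer 2) := e'' ^ 2 - 2 with ht''def
  have ht''2 : t'' ^ 2 = 2 := by
    apply (algebraMap ↥(ℚ⟮θ⟯ ⊔ (CyclotomicZp.zpExtension 2).layer 2) (AlgebraicClosure ℚ)).injective
    rw [map_pow, map_ofNat, ht''def, map_sub, map_pow, map_ofNat]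
    exact ht2
  have he''2 : e'' ^ 2 = 2 + t'' := by rw [ht''def]; ring
  letI : Algebra ↥ℚ⟮θ⟯ ↥(ℚ⟮θ⟯ ⊔ (CyclotomicZp.zpExtension 2).layer 2) := (inclusion hKA).toRingHom.toAlgebra
  have halg : ∀ c : ↥ℚ⟮θ⟯, algebraMap ↥ℚ⟮θ⟯ ↥(ℚ⟮θ⟯ ⊔ (CyclotomicZp.zpExtension 2).layer 2) c = inclusion hKA c := fun _ => rfl
  haveI : IsScalarTower ℚ ↥ℚ⟮θ⟯ ↥(ℚ⟮θ⟯ ⊔ (CyclotomicZp.zpExtension 2).layer 2) :=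
    IsScalarTower.of_algebraMap_eq fun q => ((inclusion hKA).commutes q).symm
  obtain ⟨b, hbθ, hb⟩ := exists_ringOfIntegers_cubic_root (p := -49) (q := -20) (r := -2) hθ
  have hb' : -2 - 20 * b - 49 * b ^ 2 + b ^ 3 = 0 := by push_cast at hb; linear_combination hb
  have hbgen : algebraMap (𝓞 ↥ℚ⟮θ⟯) ↥ℚ⟮θ⟯ b = AdjoinSimple.gen ℚ θ := Subtype.ext hbθ
  set θ'' : ↥(ℚ⟮θ⟯ ⊔ (CyclotomicZp.zpExtension 2).layer 2) := inclusion hKA (AdjoinSimple.gen ℚ θ) with hθ''def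
  set bB : 𝓞 ↥(ℚ⟮θ⟯ ⊔ (CyclotomicZp.zpExtension 2).layer 2) :=
    algebraMap (𝓞 ↥ℚ⟮θ⟯) (𝓞 ↥(ℚ⟮θ⟯ ⊔ (CyclotomicZp.zpExtension 2).layer 2)) b with hbBdef
  have RbB : -2 - 20 * bB - 49 * bB ^ 2 + bB ^ 3 = 0 := by
    have h := congrArg (algebraMap (𝓞 ↥ℚ⟮θ⟯) (𝓞 ↥(ℚ⟮θ⟯ ⊔ (CyclotomicZp.zpExtension 2).layer 2))) hb'
    simp only [map_add, map_sub, map_mul, map_pow, map_zero, map_ofNat, map_zero, map_neg, map_one] at h; exact h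
  have hbBval : algebraMap (𝓞 ↥(ℚ⟮θ⟯ ⊔ (CyclotomicZp.zpExtension 2).layer 2)) ↥(ℚ⟮θ⟯ ⊔ (CyclotomicZp.zpExtension 2).layer 2) bB = θ'' := by
    rw [hbBdef, hθ''def, ← IsScalarTower.algebraMap_apply,
      IsScalarTower.algebraMap_apply (𝓞 ↥ℚ⟮θ⟯) ↥ℚ⟮θ⟯ ↥(ℚ⟮θ⟯ ⊔ (CyclotomicZp.zpExtension 2).layer 2), hbgen, halg]
  have hθ''rel : -2 - 20 * θ'' - 49 * θ'' ^ 2 + θ'' ^ 3 = 0 := by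
    have h := congrArg (algebraMap (𝓞 ↥(ℚ⟮θ⟯ ⊔ (CyclotomicZp.zpExtension 2).layer 2)) ↥(ℚ⟮θ⟯ ⊔ (CyclotomicZp.zpExtension 2).layer 2)) RbB
    simp only [map_add, map_sub, map_mul, map_pow, map_zero, map_ofNat, map_zero, map_neg, map_one, hbBval] at h; exact h
  -- `ω`
  set ξ'' : ↥(ℚ⟮θ⟯ ⊔ (CyclotomicZp.zpExtension 2).layer 2) := ((0) + t'' * (-20 - 49 * θ'' + θ'' ^ 2)) / 2 with hξ''def
  have hξsq : ξ'' ^ 2 = (0) * ξ'' + (151 + 491 * θ'' - 10 * θ'' ^ 2) := by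
    rw [hξ''def]
    linear_combination ((100 : ↥(ℚ⟮θ⟯ ⊔ (CyclotomicZp.zpExtension 2).layer 2)) + (490 : ↥(ℚ⟮θ⟯ ⊔ (CyclotomicZp.zpExtension 2).layer 2)) * θ'' + ((2361 : ↥(ℚ⟮θ⟯ ⊔ (CyclotomicZp.zpExtension 2).layer 2)) / 4) * θ'' ^ 2 + ((-49 : ↥(ℚ⟮θ⟯ ⊔ (CyclotomicZp.zpExtension 2).layer 2)) / 2) * θ'' ^ 3 + ((1 : ↥(ℚ⟮θ⟯ ⊔ (CyclotomicZp.zpExtension 2).layer 2)) / 4) * θ'' ^ 4) * ht''2 + (((-49 : ↥(ℚ⟮θ⟯ ⊔ (CyclotomicZp.zpExtension 2).layer 2)) / 2) + ((1 : ↥(ℚ⟮θ⟯ ⊔ (CyclotomicZp.zpExtension 2).layer 2)) / 2) * θ'') * hθ''rel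
  have hξint : IsIntegral ℤ ξ'' := by
    refine isIntegral_of_monic_sextic_eval ξ'' (-2) (0) (2441) (0) (-102) (0) ?_
    rw [hξ''def]
    push_cast
    linear_combination (((1149054319361 : ↥(ℚ⟮θ⟯ ⊔ (CyclotomicZp.zpExtension 2).layer 2)) / 4) + (3092953192081 : ↥(ℚ⟮θ⟯ ⊔ (CyclotomicZp.zpExtension 2).layer 2)) * θ'' + (1162770000 : ↥(ℚ⟮θ⟯ ⊔ (CyclotomicZp.zpExtension 2).layer 2)) * t'' ^ 2 + ((37221354480697 : ↥(ℚ⟮θ⟯ ⊔ (CyclotomicZp.zpExtension 2).layer 2)) / 4) * θ'' ^ 2 + (13727224375 : ↥(ℚ⟮θ⟯ ⊔ (CyclotomicZp.zpExtension 2).layer 2)) * θ'' * t'' ^ 2 + ((23553104303985 : ↥(ℚ⟮θ⟯ ⊔ (CyclotomicZp.zpExtension 2).layer 2)) / 4) * θ'' ^ 3 + (1000000 : ↥(ℚ⟮θ⟯ ⊔ (CyclotomicZp.zpExtension 2).layer 2)) * t'' ^ 4 + ((102899126635 : ↥(ℚ⟮θ⟯ ⊔ (CyclotomicZp.zpExtension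 2).layer 2)) / 2) * θ'' ^ 2 * t'' ^ 2 + ((22141969607989 : ↥(ℚ⟮θ⟯ ⊔ (CyclotomicZp.zpExtension 2).layer 2)) / 16) * θ'' ^ 4 + (14700000 : ↥(ℚ⟮θ⟯ ⊔ (CyclotomicZp.zpExtension 2).layer 2)) * θ'' * t'' ^ 4 + ((1139751182961 : ↥(ℚ⟮θ⟯ ⊔ (CyclotomicZp.zpExtension 2).layer 2)) / 16) * θ'' ^ 3 * t'' ^ 2 + ((-1785433171787 : ↥(ℚ⟮θ⟯ ⊔ (CyclotomicZp.zpExtension 2).layer 2)) / 8) * θ'' ^ 5 + (89737500 : ↥(ℚ⟮θ⟯ ⊔ (CyclotomicZp.zpExtension 2).layer 2)) * θ'' ^ 2 * t'' ^ 4 + ((432239179677 : ↥(ℚ⟮θ⟯ ⊔ (CyclotomicZp.zpExtension 2).layer 2)) / 8) * θ'' ^ 4 * t'' ^ 2 + ((196185061055 : ↥(ℚ⟮θ⟯ ⊔ (CyclotomicZp.zpExtension 2).layer 2)) / 16) * θ'' ^ 6 + (290447500 : ↥(ℚ⟮θ⟯ ⊔ (CyclotomicZp.zpExtension 2).layer 2))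 * θ'' ^ 3 * t'' ^ 4 + ((482129269743 : ↥(ℚ⟮θ⟯ ⊔ (CyclotomicZp.zpExtension 2).layer 2)) / 32) * θ'' ^ 5 * t'' ^ 2 + ((-688593315 : ↥(ℚ⟮θ⟯ ⊔ (CyclotomicZp.zpExtension 2).layer 2)) / 2) * θ'' ^ 7 + ((2089920375 : ↥(ℚ⟮θ⟯ ⊔ (CyclotomicZp.zpExtension 2).layer 2)) / 4) * θ'' ^ 4 * t'' ^ 4 + ((-37261609685 : ↥(ℚ⟮θ⟯ ⊔ (CyclotomicZp.zpExtension 2).layer 2)) / 16) * θ'' ^ 6 * t'' ^ 2 + ((85608251 : ↥(ℚ⟮θ⟯ ⊔ (CyclotomicZp.zpExtension 2).layer 2)) / 16) * θ'' ^ 8 + ((3887121735 : ↥(ℚ⟮θ⟯ ⊔ (CyclotomicZp.zpExtension 2).layer 2)) / 8) * θ'' ^ 5 * t'' ^ 4 + ((4049884109 : ↥(ℚ⟮θ⟯ ⊔ (CyclotomicZp.zpExtension 2).layer 2)) / 32) * θ'' ^ 7 * t'' ^ 2 + ((-351967 : ↥(ℚ⟮θ⟯ ⊔ (CyclotomicZp.zpExtension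 2).layer 2)) / 8) * θ'' ^ 9 + ((10468682601 : ↥(ℚ⟮θ⟯ ⊔ (CyclotomicZp.zpExtension 2).layer 2)) / 64) * θ'' ^ 6 * t'' ^ 4 + ((-14142289 : ↥(ℚ⟮θ⟯ ⊔ (CyclotomicZp.zpExtension 2).layer 2)) / 4) * θ'' ^ 8 * t'' ^ 2 + ((2401 : ↥(ℚ⟮θ⟯ ⊔ (CyclotomicZp.zpExtension 2).layer 2)) / 16) * θ'' ^ 10 + ((-777424347 : ↥(ℚ⟮θ⟯ ⊔ (CyclotomicZp.zpExtension 2).layer 2)) / 32) * θ'' ^ 7 * t'' ^ 4 + ((1752977 : ↥(ℚ⟮θ⟯ ⊔ (CyclotomicZp.zpExtension 2).layer 2)) / 32) * θ'' ^ 9 * t'' ^ 2 + ((83596815 : ↥(ℚ⟮θ⟯ ⊔ (CyclotomicZp.zpExtension 2).layer 2)) / 64) * θ'' ^ 8 * t'' ^ 4 + ((-7193 : ↥(ℚ⟮θ⟯ ⊔ (CyclotomicZp.zpExtension 2).layer 2)) / 16) * θ'' ^ 10 * t'' ^ 2 + ((-580895 : ↥(ℚ⟮θ⟯ ⊔ (CyclotomicZp.zpExtension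 2).layer 2)) / 16) * θ'' ^ 9 * t'' ^ 4 + ((49 : ↥(ℚ⟮θ⟯ ⊔ (CyclotomicZp.zpExtension 2).layer 2)) / 32) * θ'' ^ 11 * t'' ^ 2 + ((35895 : ↥(ℚ⟮θ⟯ ⊔ (CyclotomicZp.zpExtension 2).layer 2)) / 64) * θ'' ^ 10 * t'' ^ 4 + ((-147 : ↥(ℚ⟮θ⟯ ⊔ (CyclotomicZp.zpExtension 2).layer 2)) / 32) * θ'' ^ 11 * t'' ^ 4 + ((1 : ↥(ℚ⟮θ⟯ ⊔ (CyclotomicZp.zpExtension 2).layer 2)) / 64) * θ'' ^ 12 * t'' ^ 4) * ht''2 + (((-1149054319357 : ↥(ℚ⟮θ⟯ ⊔ (CyclotomicZp.zpExtension 2).layer 2)) / 4) + ((-440634787377 : ↥(ℚ⟮θ⟯ ⊔ (CyclotomicZp.zpExtension 2).layer 2)) / 2) * θ'' + ((1139751182961 : ↥(ℚ⟮θ⟯ ⊔ (CyclotomicZp.zpExtension 2).layer 2)) / 8) * t'' ^ 2 + ((-513655817821 : ↥(ℚ⟮θ⟯ ⊔ (CyclotomicZp.zpExtension 2).layer 2))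 / 8) * θ'' ^ 2 + ((432239179677 : ↥(ℚ⟮θ⟯ ⊔ (CyclotomicZp.zpExtension 2).layer 2)) / 4) * θ'' * t'' ^ 2 + ((63504413829 : ↥(ℚ⟮θ⟯ ⊔ (CyclotomicZp.zpExtension 2).layer 2)) / 8) * θ'' ^ 3 + (580895000 : ↥(ℚ⟮θ⟯ ⊔ (CyclotomicZp.zpExtension 2).layer 2)) * t'' ^ 4 + ((482129269743 : ↥(ℚ⟮θ⟯ ⊔ (CyclotomicZp.zpExtension 2).layer 2)) / 16) * θ'' ^ 2 * t'' ^ 2 + (-341372553 : ↥(ℚ⟮θ⟯ ⊔ (CyclotomicZp.zpExtension 2).layer 2)) * θ'' ^ 4 + ((2089920375 : ↥(ℚ⟮θ⟯ ⊔ (CyclotomicZp.zpExtension 2).layer 2)) / 2) * θ'' * t'' ^ 4 + ((-37261609685 : ↥(ℚ⟮θ⟯ ⊔ (CyclotomicZp.zpExtension 2).layer 2)) / 8) * θ'' ^ 3 * t'' ^ 2 + ((28464153 : ↥(ℚ⟮θ⟯ ⊔ (CyclotomicZp.zpExtension 2).layer 2)) / 4) * θ'' ^ 5 + ((3887121735 :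 ↥(ℚ⟮θ⟯ ⊔ (CyclotomicZp.zpExtension 2).layer 2)) / 4) * θ'' ^ 2 * t'' ^ 4 + ((4049884109 : ↥(ℚ⟮θ⟯ ⊔ (CyclotomicZp.zpExtension 2).layer 2)) / 16) * θ'' ^ 4 * t'' ^ 2 + ((-586285 : ↥(ℚ⟮θ⟯ ⊔ (CyclotomicZp.zpExtension 2).layer 2)) / 8) * θ'' ^ 6 + ((10468682601 : ↥(ℚ⟮θ⟯ ⊔ (CyclotomicZp.zpExtension 2).layer 2)) / 32) * θ'' ^ 3 * t'' ^ 4 + ((-14142289 : ↥(ℚ⟮θ⟯ ⊔ (CyclotomicZp.zpExtension 2).layer 2)) / 2) * θ'' ^ 5 * t'' ^ 2 + ((2401 : ↥(ℚ⟮θ⟯ ⊔ (CyclotomicZp.zpExtension 2).layer 2)) / 8) * θ'' ^ 7 + ((-777424347 : ↥(ℚ⟮θ⟯ ⊔ (CyclotomicZp.zpExtension 2).layer 2)) / 16) * θ'' ^ 4 * t'' ^ 4 + ((1752977 : ↥(ℚ⟮θ⟯ ⊔ (CyclotomicZp.zpExtension 2).layer 2)) / 16) * θ'' ^ 6 * t''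 ^ 2 + ((83596815 : ↥(ℚ⟮θ⟯ ⊔ (CyclotomicZp.zpExtension 2).layer 2)) / 32) * θ'' ^ 5 * t'' ^ 4 + ((-7193 : ↥(ℚ⟮θ⟯ ⊔ (CyclotomicZp.zpExtension 2).layer 2)) / 8) * θ'' ^ 7 * t'' ^ 2 + ((-580895 : ↥(ℚ⟮θ⟯ ⊔ (CyclotomicZp.zpExtension 2).layer 2)) / 8) * θ'' ^ 6 * t'' ^ 4 + ((49 : ↥(ℚ⟮θ⟯ ⊔ (CyclotomicZp.zpExtension 2).layer 2)) / 16) * θ'' ^ 8 * t'' ^ 2 + ((35895 : ↥(ℚ⟮θ⟯ ⊔ (CyclotomicZp.zpExtension 2).layer 2)) / 32) * θ'' ^ 7 * t'' ^ 4 + ((-147 : ↥(ℚ⟮θ⟯ ⊔ (CyclotomicZp.zpExtension 2).layer 2)) / 16) * θ'' ^ 8 * t'' ^ 4 + ((1 : ↥(ℚ⟮θ⟯ ⊔ (CyclotomicZp.zpExtension 2).layer 2)) / 32) * θ'' ^ 9 * t'' ^ 4) * hθ''rel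
  set xB : 𝓞 ↥(ℚ⟮θ⟯ ⊔ (CyclotomicZp.zpExtension 2).layer 2) := ⟨ξ'', hξint⟩ with hxBdef
  have hxBval : algebraMap (𝓞 ↥(ℚ⟮θ⟯ ⊔ (CyclotomicZp.zpExtension 2).layer 2)) ↥(ℚ⟮θ⟯ ⊔ (CyclotomicZp.zpExtension 2).layer 2) xB = ξ'' := rfl
  have RxB : xB ^ 2 = (0) * xB + (151 + 491 * bB - 10 * bB ^ 2) := by
    apply NumberField.RingOfIntegers.coe_injective
    simp only [map_add, map_sub, map_mul, map_pow, map_zero, map_ofNat, map_neg, map_one, hxBval, hbBval]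
    linear_combination hξsq
  -- `p`
  set p'' : ↥(ℚ⟮θ⟯ ⊔ (CyclotomicZp.zpExtension 2).layer 2) := e'' * ((20 + 49 * θ'' - θ'' ^ 2) + t'' * (51 + 246 * θ'' - 5 * θ'' ^ 2)) / 2 with hp''def
  have hpsq : p'' ^ 2 = 810 - 121 * ξ'' + 3442 * θ'' - 541 * θ'' * ξ'' - 70 * θ'' ^ 2 + 11 * θ'' ^ 2 * ξ'' := by
    rw [hp''def, hξ''def]
    linear_combination ((100 : ↥(ℚ⟮θ⟯ ⊔ (CyclotomicZp.zpExtension 2).layer 2)) + (510 : ↥(ℚ⟮θ⟯ ⊔ (CyclotomicZp.zpExtension 2).layer 2)) * t'' + (490 : ↥(ℚ⟮θ⟯ ⊔ (CyclotomicZp.zpExtension 2).layer 2)) * θ'' + ((2601 : ↥(ℚ⟮θ⟯ ⊔ (CyclotomicZp.zpExtension 2).layer 2)) / 4) * t'' ^ 2 + ((7419 : ↥(ℚ⟮θ⟯ ⊔ (CyclotomicZp.zpExtension 2).layer 2)) / 2) * θ'' * t'' + ((2361 : ↥(ℚ⟮θ⟯ ⊔ (CyclotomicZp.zpExtension 2).layer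 2)) / 4) * θ'' ^ 2 + (6273 : ↥(ℚ⟮θ⟯ ⊔ (CyclotomicZp.zpExtension 2).layer 2)) * θ'' * t'' ^ 2 + ((11903 : ↥(ℚ⟮θ⟯ ⊔ (CyclotomicZp.zpExtension 2).layer 2)) / 2) * θ'' ^ 2 * t'' + ((-49 : ↥(ℚ⟮θ⟯ ⊔ (CyclotomicZp.zpExtension 2).layer 2)) / 2) * θ'' ^ 3 + ((30003 : ↥(ℚ⟮θ⟯ ⊔ (CyclotomicZp.zpExtension 2).layer 2)) / 2) * θ'' ^ 2 * t'' ^ 2 + ((-491 : ↥(ℚ⟮θ⟯ ⊔ (CyclotomicZp.zpExtension 2).layer 2)) / 2) * θ'' ^ 3 * t'' + ((1 : ↥(ℚ⟮θ⟯ ⊔ (CyclotomicZp.zpExtension 2).layer 2)) / 4) * θ'' ^ 4 + (-615 : ↥(ℚ⟮θ⟯ ⊔ (CyclotomicZp.zpExtension 2).layer 2)) * θ'' ^ 3 * t'' ^ 2 + ((5 : ↥(ℚ⟮θ⟯ ⊔ (CyclotomicZp.zpExtension 2).layer 2)) / 2) * θ'' ^ 4 * t'' + ((25 : ↥(ℚ⟮θ⟯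 ⊔ (CyclotomicZp.zpExtension 2).layer 2)) / 4) * θ'' ^ 4 * t'' ^ 2) * he''2 + (((3621 : ↥(ℚ⟮θ⟯ ⊔ (CyclotomicZp.zpExtension 2).layer 2)) / 2) + ((2601 : ↥(ℚ⟮θ⟯ ⊔ (CyclotomicZp.zpExtension 2).layer 2)) / 4) * t'' + ((32511 : ↥(ℚ⟮θ⟯ ⊔ (CyclotomicZp.zpExtension 2).layer 2)) / 2) * θ'' + (6273 : ↥(ℚ⟮θ⟯ ⊔ (CyclotomicZp.zpExtension 2).layer 2)) * θ'' * t'' + ((71909 : ↥(ℚ⟮θ⟯ ⊔ (CyclotomicZp.zpExtension 2).layer 2)) / 2) * θ'' ^ 2 + ((30003 : ↥(ℚ⟮θ⟯ ⊔ (CyclotomicZp.zpExtension 2).layer 2)) / 2) * θ'' ^ 2 * t'' + ((-2951 : ↥(ℚ⟮θ⟯ ⊔ (CyclotomicZp.zpExtension 2).layer 2)) / 2) * θ'' ^ 3 + (-615 : ↥(ℚ⟮θ⟯ ⊔ (CyclotomicZp.zpExtension 2).layer 2)) * θ'' ^ 3 * t'' + (15 : ↥(ℚ⟮θ⟯ ⊔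 (CyclotomicZp.zpExtension 2).layer 2)) * θ'' ^ 4 + ((25 : ↥(ℚ⟮θ⟯ ⊔ (CyclotomicZp.zpExtension 2).layer 2)) / 4) * θ'' ^ 4 * t'') * ht''2 + (((-3011 : ↥(ℚ⟮θ⟯ ⊔ (CyclotomicZp.zpExtension 2).layer 2)) / 2) + ((-2421 : ↥(ℚ⟮θ⟯ ⊔ (CyclotomicZp.zpExtension 2).layer 2)) / 4) * t'' + ((61 : ↥(ℚ⟮θ⟯ ⊔ (CyclotomicZp.zpExtension 2).layer 2)) / 2) * θ'' + ((49 : ↥(ℚ⟮θ⟯ ⊔ (CyclotomicZp.zpExtension 2).layer 2)) / 4) * θ'' * t'') * hθ''rel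
  have hcoeU : algebraMap (𝓞 ↥(ℚ⟮θ⟯ ⊔ (CyclotomicZp.zpExtension 2).layer 2)) ↥(ℚ⟮θ⟯ ⊔ (CyclotomicZp.zpExtension 2).layer 2)
      (810 - 121 * xB + 3442 * bB - 541 * bB * xB - 70 * bB ^ 2 + 11 * bB ^ 2 * xB) =
      810 - 121 * ξ'' + 3442 * θ'' - 541 * θ'' * ξ'' - 70 * θ'' ^ 2 + 11 * θ'' ^ 2 * ξ'' := by
    simp only [map_add, map_sub, map_mul, map_pow, map_zero, map_ofNat, map_neg, map_one, hbBval, hxBval]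
  have hpint : IsIntegral ℤ p'' := by
    refine IsIntegral.of_pow two_pos ?_
    rw [hpsq, ← hcoeU]
    exact NumberField.RingOfIntegers.isIntegral_coe _
  set pB : 𝓞 ↥(ℚ⟮θ⟯ ⊔ (CyclotomicZp.zpExtension 2).layer 2) := ⟨p'', hpint⟩ with hpBdef
  have hpBval : algebraMap (𝓞 ↥(ℚ⟮θ⟯ ⊔ (CyclotomicZp.zpExtension 2).layer 2)) ↥(ℚ⟮θ⟯ ⊔ (CyclotomicZp.zpExtension 2).layer 2) pB = p'' := rfl
  have RpB : pB ^ 2 = 810 - 121 * xB + 3442 * bB - 541 * bB * xB - 70 * bB ^ 2 + 11 * bB ^ 2 * xB := by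
    apply NumberField.RingOfIntegers.coe_injective
    rw [map_pow, hpBval, hcoeU, hpsq]
  refine ⟨bB, xB, pB, hbBval, ?_, ?_, RbB, RxB, RpB⟩
  · change ξ'' = _
    rw [hξ''def, ht''def, hθ''def]
  · change p'' = _
    rw [hp''def, ht''def, hθ''def]

end Summit.BirchSwinnertonDyer.BirchSwinnertonDyer.Theorems.AddKatoTwo

end
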